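import Summits.AtomisticToContinuum.HydrodynamicLimit.Theorems.JParityClosureEvenStressEnskogVelocityEquilibrationRung0Pathwise
import Summits.AtomisticToContinuum.HydrodynamicLimit.Theorems.JParityClosureEvenStressEnskogVelocityEquilibrationRung0SpaceIntegral
import Summits.AtomisticToContinuum.HydrodynamicLimit.Theorems.JParityClosureEvenStressEnskogEnskogIdentificationWeight
import Summits.AtomisticToContinuum.HydrodynamicLimit.Theorems.JParityClosureOddContactSymmetryGibbsInvariance
import HarnessLib

/-!
# Velocity equilibration at rung 0 from the pointwise `L¹` deviation
# (stub S3b3 `stub_velocityEquilibrationRung0_of_deviation` of the line `preshock-kinetic-slaving`,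
# crux `JParityClosure.EvenStressEnskog`, stmt-AtomisticToContinuum-13079)

**S3b at rung 0.**  At global equilibrium (constant profiles `a, θ > 0`, `u`; rung-0 local Gibbs law
`G_N = localGibbsLaw σ a u θ N (Φ N)`) the one-body `r`-scale statistic `oneBodyStat` of a continuous
quadratic-growth test function `F(v, u_r, θ_r)` with a continuous time–space weight `χ` and a
continuous density cutoff `k` vanishing on `[η₀, ∞)` is `η`-close to its local-Maxwellian prediction
`oneBodyPred` in `G_N`-probability for `N ≥ N₀(r)`, every `0 < r < r₀ := 1/2` — GIVEN, as hypotheses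
stated verbatim, the rung-0 local statistics (registered stub S3b1: `G_N` is a probability measure with
bounded velocity moments `∫⁻ (N+1)⁻¹Σ‖vᵢ‖² dG_N ≤ K`, …) and the pointwise `L¹` deviation (conclusion of
the registered stub S3b2: `∫⁻ |D(·, x)| dG_N ≤ ε` for `N ≥ N₀(x, ε)`, `D = S − ρ_r H` the window
deviation).  Threshold `η₀ := 1`, `σ₀ := min σ₀^{S3b1} σ₀^{S3b2}`.

Route (everything in `∫⁻`, no energy truncation):
1. PATHWISE (`ofReal_abs_oneBodyStat_sub_oneBodyPred_le`, helper file *Pathwise*): on the good set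
   `ofReal |oneBodyStat − oneBodyPred| ≤ ofReal (C_χ C_k) ∫⁻₀^τ ∫⁻_x ofReal |D(Φ_s z, x)|`.
2. MEASURABLE MODIFICATION & MARKOV (`measure_lt_abs_oneBodyStat_sub_oneBodyPred_le`, this file): with
   the jointly measurable `Ψ(s, z) = good.piecewise Φ_s id z` (`measurable_piecewise_flow_torus`) the
   majorant `g(z) = ∫⁻₀^τ Q(Ψ(s, z)) ds`, `Q(w) = ∫⁻_x ofReal |D(w, x)|`, is Borel; `G_N`-a.e. `z` is good
   (`localGibbsLaw_eq`, `localGibbsMeasure_absolutelyContinuous`, `HardSphereFlow.ae_mem_good`), so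
   `G_N{η < |…|} ≤ G_N{ofReal η ≤ ofReal (C_χ C_k) g} ≤ ofReal (C_χ C_k) (∫⁻ g dG_N) / ofReal η`.
3. TONELLI & STATIONARITY: `∫⁻ g dG_N = ∫⁻₀^τ ∫⁻ Q(Φ_s z) dG_N ds = τ ∫⁻ Q dG_N`
   (`lintegral_lintegral_swap`, `lintegral_comp_flow_localGibbsLaw_const` — the homogeneous Gibbs law
   is invariant under every hard-sphere flow).
4. SPACE INTEGRAL (`exists_lintegral_lintegral_windowDeviation_le`, helper file *SpaceIntegral*):
   `∫⁻ Q dG_N = ∫⁻_w ∫⁻_x ofReal |D| ≤ ε'` for `N ≥ N₀` (Tonelli, dominated convergence on the torus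
   with the moment majorant of S3b1, pointwise smallness from S3b2).
5. BOOKKEEPING: `ε' := δ η / ((C_χ C_k + 1) τ)`.

References: H. Spohn, *Large Scale Dynamics of Interacting Particles* (1991), Part I §2.3, §3.2
(local equilibrium; empirical fields tested along the flow; equilibrium measures are stationary).
-/

noncomputable section

open scoped BigOperators InnerProductSpace Topology ENNReal
open MeasureTheory Filter Set
open Literature.MathematicalPhysics.KineticTheory Literature.Analysis.FluidPDE
open Literature.MathematicalPhysics.KineticTheory.StationaryMicroscale

namespace Summit.AtomisticToContinuum.HydrodynamicLimit.Theorems.EvenStressEnskog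

variable {N : ℕ}

/-! ## Markov, Tonelli and stationarity at rung 0 -/

open scoped Classical in
/-- **The Markov–Tonelli–stationarity step at rung 0.**  For constant profiles, `σ ≥ 0`, a flow `Φ`
whose rung-0 Gibbs law `G_N` is a probability measure, `r > 0`, continuous `χ, k, F` with
`|χ| ≤ C_χ` on `[0, τ] × 𝕋³` and `|k| ≤ C_k` on `[0, ∞)`, and `η > 0`:
`G_N{η < |oneBodyStat − oneBodyPred|} ≤ ofReal (C_χ C_k) (ofReal τ ∫⁻_w ∫⁻_x ofReal |D(w, x)| dG_N) / ofReal η`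
— the pathwise bound on the good set, the measurable modification `good.piecewise Φ_s id` of the flow,
Markov's inequality, Tonelli in `(s, z)` and the invariance of `G_N` under each `Φ_s`
(`lintegral_comp_flow_localGibbsLaw_const`). [folklore] -/
theorem measure_lt_abs_oneBodyStat_sub_oneBodyPred_le {σ : ℝ} (hσ : 0 ≤ σ) (a θ : ℝ) (u : V3)
    (Φ : HardSphereFlow (Torus.geometry (Fin 3)) (hsDiameter σ N) (N + 1))
    [IsProbabilityMeasure (localGibbsLaw σ (fun _ => a) (fun _ => u) (fun _ => θ) N Φ)]
    {r : ℝ} (hr : 0 < r) (τ : ℝ) {χ : ℝ × T3 → ℝ} (hχ : Continuous χ) {k : ℝ → ℝ}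
    (hk : Continuous k) {F : V3 × V3 × ℝ → ℝ} (hF : Continuous F) {Cχ Ck : ℝ}
    (hχb : ∀ s ∈ Icc (0 : ℝ) τ, ∀ x, |χ (s, x)| ≤ Cχ) (hkb : ∀ a, 0 ≤ a → |k a| ≤ Ck)
    {η : ℝ} (hη : 0 < η) :
    localGibbsLaw σ (fun _ => a) (fun _ => u) (fun _ => θ) N Φ
        {z | η < |oneBodyStat σ N Φ τ χ k F r z - oneBodyPred σ N Φ τ χ k F r z|} ≤
      ENNReal.ofReal (Cχ * Ck) * (ENNReal.ofReal τ *
        ∫⁻ w, (∫⁻ x : T3, ENNReal.ofReal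
          |(∫ q, coneKernel r q.1 x *
                F (q.2, KineticEntropyBalance.uC r w x, mollTemperature r w x) ∂(empiricalMeasure w)) -
            mollDensity r w x *
              ∫ v, F (v, KineticEntropyBalance.uC r w x, mollTemperature r w x) *
                localMaxwellian 1 (mollTemperature r w x) (KineticEntropyBalance.uC r w x) v|)
          ∂(localGibbsLaw σ (fun _ => a) (fun _ => u) (fun _ => θ) N Φ)) / ENNReal.ofReal η := by
  set P := localGibbsLaw σ (fun _ => a) (fun _ => u) (fun _ => θ) N Φ with hP
  -- `P`-a.e. configuration is good
  have hgood : ∀ᵐ z ∂P, z ∈ Φ.good := by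
    rw [hP, localGibbsLaw_eq]
    exact (localGibbsMeasure_absolutelyContinuous σ _ _ _ N Φ).ae_le Φ.ae_mem_good
  -- the deviation `D(w, x)` and its space integral `Q(w) = ∫⁻ₓ ofReal |D(w, x)|`
  set D : Config (N + 1) (Fin 3) T3 → T3 → ℝ := fun w x =>
    (∫ q, coneKernel r q.1 x *
        F (q.2, KineticEntropyBalance.uC r w x, mollTemperature r w x) ∂(empiricalMeasure w)) -
      mollDensity r w x *
        ∫ v, F (v, KineticEntropyBalance.uC r w x, mollTemperature r w x) *
          localMaxwellian 1 (mollTemperature r w x) (KineticEntropyBalance.uC r w x) v with hD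
  have hDm : Measurable fun q : Config (N + 1) (Fin 3) T3 × T3 => D q.1 q.2 :=
    measurable_windowDeviation_prod r hF
  set Q : Config (N + 1) (Fin 3) T3 → ℝ≥0∞ := fun w => ∫⁻ x : T3, ENNReal.ofReal |D w x| with hQ
  have hQm : Measurable Q := hDm.abs.ennreal_ofReal.lintegral_prod_right'
  -- the measurable modification of the flow and the majorant `g`
  set Ψ : ℝ × Config (N + 1) (Fin 3) T3 → Config (N + 1) (Fin 3) T3 :=
    fun p => Φ.good.piecewise (Φ.flow p.1) id p.2 with hΨ
  have hΨm : Measurable Ψ := measurable_piecewise_flow_torus Φ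
  have hΨeq : ∀ z ∈ Φ.good, ∀ s, Ψ (s, z) = Φ.flow s z := fun z hz s => piecewise_flow_of_mem Φ s hz
  have hQΨ : Measurable fun p : ℝ × Config (N + 1) (Fin 3) T3 => Q (Ψ p) := hQm.comp hΨm
  set g : Config (N + 1) (Fin 3) T3 → ℝ≥0∞ := fun z => ∫⁻ s in Icc (0 : ℝ) τ, Q (Ψ (s, z)) with hg
  have hgm : Measurable g := hQΨ.lintegral_prod_left'
  -- on the good set the event is inside `{ofReal η ≤ ofReal (Cχ Ck) g}`
  have hsub : ∀ z ∈ Φ.good, η < |oneBodyStat σ N Φ τ χ k F r z - oneBodyPred σ N Φ τ χ k F r z| →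
      ENNReal.ofReal η ≤ ENNReal.ofReal (Cχ * Ck) * g z := by
    intro z hz h
    have h1 := ofReal_abs_oneBodyStat_sub_oneBodyPred_le hσ Φ hz hr τ hχ hk hF hχb hkb
    have h2 : g z = ∫⁻ s in Icc (0 : ℝ) τ, Q (Φ.flow s z) := lintegral_congr fun s => by rw [hΨeq z hz s]
    rw [h2]
    exact (ENNReal.ofReal_le_ofReal h.le).trans h1
  -- Markov
  have hη' : ENNReal.ofReal η ≠ 0 := (ENNReal.ofReal_pos.2 hη).ne'
  have hMarkov : P {z | η < |oneBodyStat σ N Φ τ χ k F r z - oneBodyPred σ N Φ τ χ k F r z|} ≤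
      (∫⁻ z, ENNReal.ofReal (Cχ * Ck) * g z ∂P) / ENNReal.ofReal η :=
    calc P {z | η < |oneBodyStat σ N Φ τ χ k F r z - oneBodyPred σ N Φ τ χ k F r z|}
        ≤ P {z | ENNReal.ofReal η ≤ ENNReal.ofReal (Cχ * Ck) * g z} := by
          refine measure_mono_ae ?_
          filter_upwards [hgood] with z hz h
          exact hsub z hz h
      _ ≤ (∫⁻ z, ENNReal.ofReal (Cχ * Ck) * g z ∂P) / ENNReal.ofReal η :=
          meas_ge_le_lintegral_div (hgm.const_mul _).aemeasurable hη' ENNReal.ofReal_ne_top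
  -- Tonelli and stationarity: `∫⁻ g dP = ofReal τ * ∫⁻ Q dP`
  have hTon : ∫⁻ z, g z ∂P = ENNReal.ofReal τ * ∫⁻ w, Q w ∂P := by
    calc ∫⁻ z, g z ∂P = ∫⁻ s in Icc (0 : ℝ) τ, ∫⁻ z, Q (Ψ (s, z)) ∂P :=
          lintegral_lintegral_swap (hQΨ.comp measurable_swap).aemeasurable
      _ = ∫⁻ s in Icc (0 : ℝ) τ, ∫⁻ w, Q w ∂P := by
          refine lintegral_congr fun s => ?_
          have hae : ∫⁻ z, Q (Ψ (s, z)) ∂P = ∫⁻ z, Q (Φ.flow s z) ∂P := by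
            refine lintegral_congr_ae ?_
            filter_upwards [hgood] with z hz
            rw [hΨeq z hz s]
          rw [hae, hP, lintegral_comp_flow_localGibbsLaw_const σ a θ u N Φ s hQm]
      _ = ENNReal.ofReal τ * ∫⁻ w, Q w ∂P := by
          rw [setLIntegral_const, Real.volume_Icc, sub_zero, mul_comm]
  -- assembly
  calc P {z | η < |oneBodyStat σ N Φ τ χ k F r z - oneBodyPred σ N Φ τ χ k F r z|}
      ≤ (∫⁻ z, ENNReal.ofReal (Cχ * Ck) * g z ∂P) / ENNReal.ofReal η := hMarkov
    _ = ENNReal.ofReal (Cχ * Ck) * (ENNReal.ofReal τ * ∫⁻ w, Q w ∂P) / ENNReal.ofReal η := by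
        rw [lintegral_const_mul _ hgm, hTon]

/-! ## Bookkeeping -/

/-- The final arithmetic: with `ε' = δ η / ((M + 1) τ)`, `M (τ ε') / η ≤ δ` (`M ≥ 0`, `τ, η, δ > 0`).
[folklore] -/
theorem velocityEquilibrationBudget_le {M τ η δ : ℝ} (hM : 0 ≤ M) (hτ : 0 < τ) (hη : 0 < η)
    (hδ : 0 < δ) :
    M * (τ * (δ * η / ((M + 1) * τ))) / η ≤ δ := by
  have hid : M * (τ * (δ * η / ((M + 1) * τ))) / η = M * δ / (M + 1) := by
    field_simp
  rw [hid, div_le_iff₀ (by positivity)]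
  nlinarith

/-! ## The registered stub -/

/-- **S3b3 · VELOCITY EQUILIBRATION AT RUNG 0 FROM THE POINTWISE `L¹` DEVIATION** (registered stub
`stub_velocityEquilibrationRung0_of_deviation` of the line `preshock-kinetic-slaving`): GIVEN the
rung-0 local statistics at a window centre (text of stub S3b1: `G_N` is a probability measure, the
velocity moments `∫⁻ (N+1)⁻¹Σ‖vᵢ‖²`, `∫⁻ ((N+1)⁻¹Σ‖vᵢ‖²)²` are bounded, the `L²` laws of large
numbers and the concentration of `(ρ_r, u_r, θ_r)`) and GIVEN the pointwise `L¹` deviation (conclusion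
of stub S3b2: `∫⁻ |S − ρ_r H| dG_N ≤ ε` at every centre for large `N`), the one-body statistic
`oneBodyStat` is `η`-close to its local-Maxwellian prediction `oneBodyPred` in `G_N`-probability:
threshold `η₀ := 1`, `σ₀ := min`, `r₀ := 1/2`; flow invariance of the homogeneous Gibbs law turns the
time integral into a factor `τ` (`measure_lt_abs_oneBodyStat_sub_oneBodyPred_le`), the space integral
is `exists_lintegral_lintegral_windowDeviation_le`, and `ε' := δη/((C_χC_k + 1)τ)`. [folklore] -/
theorem stub_velocityEquilibrationRung0_of_deviation :
    (∀ (a θ : ℝ) (u : V3), 0 < a → 0 < θ → ∃ σ₀ : ℝ, 0 < σ₀ ∧ ∀ σ : ℝ, 0 < σ → σ < σ₀ →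
    ∀ Φ : (N : ℕ) → HardSphereFlow (Torus.geometry (Fin 3)) (hsDiameter σ N) (N + 1),
    (∀ N, IsProbabilityMeasure (localGibbsLaw σ (fun _ => a) (fun _ => u) (fun _ => θ) N (Φ N))) ∧
    (∃ K : ℝ, ∀ N : ℕ,
      ∫⁻ w, ENNReal.ofReal (((N + 1 : ℕ) : ℝ)⁻¹ * ∑ i, ‖(w i).2‖ ^ 2)
          ∂(localGibbsLaw σ (fun _ => a) (fun _ => u) (fun _ => θ) N (Φ N)) ≤ ENNReal.ofReal K ∧
      ∫⁻ w, ENNReal.ofReal ((((N + 1 : ℕ) : ℝ)⁻¹ * ∑ i, ‖(w i).2‖ ^ 2) ^ 2)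
          ∂(localGibbsLaw σ (fun _ => a) (fun _ => u) (fun _ => θ) N (Φ N)) ≤ ENNReal.ofReal K) ∧
    ∀ r : ℝ, 0 < r → r < 1 / 2 → ∀ x : T3,
      Tendsto (fun N : ℕ => ∫⁻ w, ENNReal.ofReal ((mollDensity r w x - 1) ^ 2)
        ∂(localGibbsLaw σ (fun _ => a) (fun _ => u) (fun _ => θ) N (Φ N))) atTop (𝓝 0) ∧
      (∀ G : V3 → ℝ, Continuous G → (∃ C : ℝ, ∀ v, |G v| ≤ C * (1 + ‖v‖ ^ 2)) →
        Tendsto (fun N : ℕ => ∫⁻ w, ENNReal.ofReal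
            (((∫ q, coneKernel r q.1 x * G q.2 ∂(empiricalMeasure w)) -
              mollDensity r w x * ∫ v, G v ∂(gaussMeasure u θ)) ^ 2)
          ∂(localGibbsLaw σ (fun _ => a) (fun _ => u) (fun _ => θ) N (Φ N))) atTop (𝓝 0)) ∧
      ∀ ι : ℝ, 0 < ι →
        Tendsto (fun N : ℕ => localGibbsLaw σ (fun _ => a) (fun _ => u) (fun _ => θ) N (Φ N)
          {w | ι ≤ |mollDensity r w x - 1| + ‖KineticEntropyBalance.uC r w x - u‖ +
            |mollTemperature r w x - θ|}) atTop (𝓝 0)) →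
    (∀ (a θ : ℝ) (u : V3), 0 < a → 0 < θ → ∃ σ₀ : ℝ, 0 < σ₀ ∧ ∀ σ : ℝ, 0 < σ → σ < σ₀ →
    ∀ Φ : (N : ℕ) → HardSphereFlow (Torus.geometry (Fin 3)) (hsDiameter σ N) (N + 1),
    ∀ F : V3 × V3 × ℝ → ℝ, Continuous F →
    (∃ C : ℝ, ∀ q, |F q| ≤ C * (1 + ‖q.1‖ ^ 2 + ‖q.2.1‖ ^ 2 + |q.2.2|)) →
    ∀ r : ℝ, 0 < r → r < 1 / 2 → ∀ x : T3, ∀ ε : ℝ, 0 < ε → ∃ N₀ : ℕ, ∀ N : ℕ, N₀ ≤ N →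
      ∫⁻ w, ENNReal.ofReal
          |(∫ q, coneKernel r q.1 x *
                F (q.2, KineticEntropyBalance.uC r w x, mollTemperature r w x) ∂(empiricalMeasure w)) -
            mollDensity r w x *
              ∫ v, F (v, KineticEntropyBalance.uC r w x, mollTemperature r w x) *
                localMaxwellian 1 (mollTemperature r w x) (KineticEntropyBalance.uC r w x) v|
        ∂(localGibbsLaw σ (fun _ => a) (fun _ => u) (fun _ => θ) N (Φ N)) ≤ ENNReal.ofReal ε) →
    ∃ η₀ : ℝ, 0 < η₀ ∧ ∀ (a θ : ℝ) (u : V3), 0 < a → 0 < θ → ∃ σ₀ : ℝ, 0 < σ₀ ∧ ∀ σ : ℝ, 0 < σ → σ < σ₀ →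
    ∀ Φ : (N : ℕ) → HardSphereFlow (Torus.geometry (Fin 3)) (hsDiameter σ N) (N + 1),
    ∀ τ : ℝ, 0 < τ →
    ∀ χ : ℝ × T3 → ℝ, Continuous χ → ∀ k : ℝ → ℝ, Continuous k → (∀ b, η₀ ≤ b → k b = 0) →
    ∀ F : V3 × V3 × ℝ → ℝ, Continuous F →
    (∃ C : ℝ, ∀ q, |F q| ≤ C * (1 + ‖q.1‖ ^ 2 + ‖q.2.1‖ ^ 2 + |q.2.2|)) →
    ∀ η δ : ℝ, 0 < η → 0 < δ → ∃ r₀ : ℝ, 0 < r₀ ∧ ∀ r : ℝ, 0 < r → r < r₀ → ∃ N₀ : ℕ, ∀ N : ℕ, N₀ ≤ N →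
      localGibbsLaw σ (fun _ => a) (fun _ => u) (fun _ => θ) N (Φ N)
        {z | η < |oneBodyStat σ N (Φ N) τ χ k F r z - oneBodyPred σ N (Φ N) τ χ k F r z|}
        ≤ ENNReal.ofReal δ := by
  intro h1 h2
  refine ⟨1, one_pos, ?_⟩
  intro a θ u ha hθ
  obtain ⟨σ₁, hσ₁, H1⟩ := h1 a θ u ha hθ
  obtain ⟨σ₂, hσ₂, H2⟩ := h2 a θ u ha hθ
  refine ⟨min σ₁ σ₂, lt_min hσ₁ hσ₂, ?_⟩
  intro σ hσ hσlt Φ τ hτ χ hχ k hk hk0 F hF hCF η δ hη hδ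
  refine ⟨1 / 2, one_half_pos, fun r hr hr2 => ?_⟩
  obtain ⟨hprob, ⟨K, hK⟩, -⟩ := H1 σ hσ (hσlt.trans_le (min_le_left _ _)) Φ
  have H2' := H2 σ hσ (hσlt.trans_le (min_le_right _ _)) Φ F hF hCF r hr hr2
  obtain ⟨C, hC⟩ := hCF
  obtain ⟨Cχ, hχb⟩ := exists_abs_le_on_Icc hχ τ
  obtain ⟨Ck, hCk0, hkb⟩ := exists_bound_of_eq_zero_of_le hk one_pos hk0
  have hCχ0 : 0 ≤ Cχ := (abs_nonneg _).trans (hχb 0 ⟨le_rfl, hτ.le⟩ 0)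
  have hM0 : 0 ≤ Cχ * Ck := mul_nonneg hCχ0 hCk0
  have hε'0 : 0 < δ * η / ((Cχ * Ck + 1) * τ) := by positivity
  obtain ⟨N₀, hN₀⟩ := exists_lintegral_lintegral_windowDeviation_le hr hF hC
    (fun N => localGibbsLaw σ (fun _ => a) (fun _ => u) (fun _ => θ) N (Φ N)) hprob
    (fun N => (hK N).1) H2' _ hε'0
  refine ⟨N₀, fun N hN => ?_⟩
  haveI := hprob N
  refine (measure_lt_abs_oneBodyStat_sub_oneBodyPred_le hσ.le a θ u (Φ N) hr τ hχ hk hF hχb hkb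
    hη).trans ?_
  calc ENNReal.ofReal (Cχ * Ck) * (ENNReal.ofReal τ *
        ∫⁻ w, (∫⁻ x : T3, ENNReal.ofReal
          |(∫ q, coneKernel r q.1 x *
                F (q.2, KineticEntropyBalance.uC r w x, mollTemperature r w x) ∂(empiricalMeasure w)) -
            mollDensity r w x *
              ∫ v, F (v, KineticEntropyBalance.uC r w x, mollTemperature r w x) *
                localMaxwellian 1 (mollTemperature r w x) (KineticEntropyBalance.uC r w x) v|)
          ∂(localGibbsLaw σ (fun _ => a) (fun _ => u) (fun _ => θ) N (Φ N))) / ENNReal.ofReal η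
      ≤ ENNReal.ofReal (Cχ * Ck) * (ENNReal.ofReal τ *
          ENNReal.ofReal (δ * η / ((Cχ * Ck + 1) * τ))) / ENNReal.ofReal η := by
        gcongr
        exact hN₀ N hN
    _ = ENNReal.ofReal (Cχ * Ck * (τ * (δ * η / ((Cχ * Ck + 1) * τ))) / η) := by
        rw [← ENNReal.ofReal_mul hτ.le, ← ENNReal.ofReal_mul hM0, ENNReal.ofReal_div_of_pos hη]
    _ ≤ ENNReal.ofReal δ := ENNReal.ofReal_le_ofReal (velocityEquilibrationBudget_le hM0 hτ hη hδ)

end Summit.AtomisticToContinuum.HydrodynamicLimit.Theorems.EvenStressEnskog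

end
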